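import Summits.Ventures.AbcSig.Recipes.BS04

/-!
# Venture AbcSig — GENERATED level file, level 22: NO newforms

HONEST FRAMING. Machine-generated by the p-lean seat's `certgen.py`. The cell's level file `N22.engine1.json`
(sha256 `4479e98990657587981c3a58288e69aec46c21e2703d7b47b0bc8bd2d3b86240`; engine-1 (modular symbols: msym)) reports `dim S₂^new(Γ₀(22)) = 0` and an EMPTY orbit list. Second engine file `N22.msgf.json` (sha256 `896e737f2ac3916b75603f41b825d6882bd2af1ef43ccfb9af71e2a58f8f4abd`, p1-msgf) also reports no orbits. [BS04, Prop. 4.1] lists this level among those with no weight-2 newforms of trivial character.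
In the Lean layer this is the computed hypothesis `NewformModel.DataComplete 22 level22Orbits` with the empty list; nothing is
certified by the kernel here (an empty list needs no certificate). No claim on ABC or any summit.
-/

namespace Summit.Ventures.AbcSig

/-- The (empty) list of newform orbits of level 22. -/
def level22Orbits : List OrbitData := []

/-- Every listed entry is at an odd prime not dividing 22 (vacuous). -/
theorem level22_wellformed :
    ∀ o ∈ level22Orbits, ∀ e ∈ o.coeffs, e.ell.Prime ∧ e.ell ≠ 2 ∧ ¬ e.ell ∣ 22 := by
  intro o ho
  simp [level22Orbits] at ho

/-- **Level 22 summary**: vacuous (no orbits); same shape as the generated `levelN_sieve` theorems. -/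
theorem level22_sieve (n : ℕ) (_hn : n.Prime) (_hmin : 7 ≤ n) (X : OrbitData → Prop) :
    ∀ o ∈ level22Orbits, (∀ e ∈ o.coeffs, e.ell.Prime ∧ e.ell ≠ 2 ∧ ¬ e.ell ∣ 22) ∧ (o.Eliminated bs04Allowed n ∨ X o) := by
  intro o ho
  simp [level22Orbits] at ho

end Summit.Ventures.AbcSig
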